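import Literature.NumberTheory.BeurlingPrimes.BVContinuation
import Literature.NumberTheory.BeurlingPrimes.BeurlingPerronFormula
import Literature.NumberTheory.BeurlingPrimes.PerronShift
import HarnessLib

/-!
# Broucke–Vindas 2024, Theorem 3.1: the Perron inversion `N_𝒫(x) = a x + O(x^{1/2} exp(c (log x)^{2/3}))`

Topic `Literature/NumberTheory/BeurlingPrimes`, grouping namespace `BV` (Broucke–Vindas 2024). Everything in this
file is PROVED.

This is the second half of the proof of BV Theorem 3.1 (verbatim the argument of Zhang 2007 / Diamond–Zhang, as BV
say), for a discrete system `P` approximating a template with prime density `f` in the sense of (1.3)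
(`BV.Approx f P A`, file `BVContinuation.lean`) whose "Riemann" density `g` has `exp(∫₁^∞ g(u)u^{−s} du) = s/(s−1)`
(for BV: `f = li′`, `g = Li′`):

"`Z(s) := log ζ_𝒫(s) − log(s/(s−1))` has analytic continuation … for `σ > 1/2`,
`|Z(s)| ≤ C(1/(σ−1/2) + √(log(|t|+1)/(σ−1/2)))` (3.2). … we will apply the Perron formula to
`N₁(x) := ∫₁ˣ N(u) du` … `N₁(x) = (1/2πi)∫_{κ−i∞}^{κ+i∞} x^{s+1} e^{Z(s)} ds/((s−1)(s+1))`. One then uses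
`N₁(x) − N₁(x−1) ≤ N(x) ≤ N₁(x+1) − N₁(x)`. Set `σ_x = 1/2 + (log x)^{−1/3}`. Then uniformly for `σ ≥ σ_x`,
`|Z(s)| ≤ C((log x)^{1/3} + (log x)^{1/6}√log(|t|+1))`. We shift the contour to the line `σ = σ_x`. By the residue
theorem … `N(x) ≤ x + 1/2 + (1/2πi)∫_{σ_x} ((x+1)^{s+1} − x^{s+1}) e^{Z(s)} ds/((s−1)(s+1))`. We split the range of
integration into two pieces: `|t| ≤ x` and `|t| > x` … This gives … `O(x^{1/2} exp(c(log x)^{2/3}))` … A similar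
reasoning applies for a lower bound for `N`."

Here, with the tree's Perron formula of order one (`BeurlingPerronFormula.lean`) and contour shift / vertical
estimate (`PerronShift.lean`):
* `BV.contZeta = s/(s−1) · e^{Z(s)}`, the continuation of `ζ_P` to `σ > 1/2`, `s ≠ 1`; its residue
  `BV.res = e^{Z(1)}` is a positive real (`res_real_pos`, limit of `(σ−1)ζ_P(σ) ≥ 0`); the regular part
  `BV.H = dslope (s e^{Z}) 1`;
* the bound `‖contZeta(u+iT)‖ ≤ B_η(|T|) := 8 e^{C/η} e^{(C/√η)√log(|T|+1)}` for `1/2 + η ≤ u ≤ 3/2`, `‖s−1‖ ≥ 1/4`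
  (from (3.2), `BVContinuation.norm_Z_le`);
* the Perron identity with the line moved to `σ_x = 1/2 + (log x)^{−1/3}` and the two estimates of the shifted
  integral (`|t| ≤ x`, `|t| > x`), giving **`intCount_sub_le`**: for `x ≥ e^{64}`,
  `|N_P(x) − a x| ≤ (a/2 + 128) x^{1/2} exp(c (log x)^{2/3})` with `a = e^{Z(1)} > 0` and an explicit
  `c = 5/2 + 3C + C²/4`.

## References
* [BrouckeVindas2024] F. Broucke, J. Vindas, *A new generalized prime random approximation procedure and some of
  its applications*, Math. Z. 307 (2024), arXiv:2102.08478, proof of Theorem 3.1 (read).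
* [BrouckeDebruyneRevesz2023] F. Broucke, G. Debruyne, Sz. Gy. Révész, arXiv:2309.01567, proof of Theorem 3.2,
  (3.5)–(3.8) (the same Perron argument).
-/

noncomputable section

open Complex Set Filter MeasureTheory Real intervalIntegral Asymptotics
open scoped Topology

namespace Literature.NumberTheory.BeurlingPrimes

open Literature.Barriers.RiemannHypothesis Literature.NumberTheory.LFunctions

namespace BV

variable {f g : ℝ → ℝ} {P : BeurlingPrimes} {A K : ℝ}

/-! ### Hypotheses and the objects -/

/-- The standing hypotheses of the Perron step: (1.3) for the prime density `f` (`|f| ≤ 2`), a Riemann density `g`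
with `0 ≤ g − f ≤ K u^{−1/2}` and `exp(∫₁^∞ g(u) u^{−s} du) = s/(s−1)` (`σ > 1`). For BV: `f = li′`, `g = Li′`.
[cite: BrouckeVindas2024, proof of Theorem 3.1] -/
structure PerronHyp (f g : ℝ → ℝ) (P : BeurlingPrimes) (A K : ℝ) : Prop where
  approx : Approx f P A
  fm : Measurable f
  fb : ∀ v, 1 < v → |f v| ≤ 2
  gm : Measurable g
  gf : ∀ u, 1 < u → 0 ≤ g u - f u ∧ g u - f u ≤ K * u ^ (-(1 / 2 : ℝ))
  g1 : ∀ s : ℂ, 1 < s.re → Complex.exp (∫ u in Ioi (1 : ℝ), (g u : ℂ) * (u : ℂ) ^ (-s)) = s / (s - 1)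

/-- The continued zeta function `G(s) = s/(s−1) · e^{Z(s)}` (`= ζ_P(s)` for `σ > 1`). [cite: BrouckeVindas2024, proof of Theorem 3.1] -/
def contZeta (f g : ℝ → ℝ) (P : BeurlingPrimes) (s : ℂ) : ℂ := s / (s - 1) * Complex.exp (Z f g P s)

/-- The numerator `s e^{Z(s)} = (s − 1) G(s)`. [cite: BrouckeVindas2024, proof of Theorem 3.1] -/
def num (f g : ℝ → ℝ) (P : BeurlingPrimes) (s : ℂ) : ℂ := s * Complex.exp (Z f g P s)

/-- The residue `a = e^{Z(1)}` of `G` at `s = 1` (the density of the integers). [cite: BrouckeVindas2024, proof of Theorem 3.1] -/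
def res (f g : ℝ → ℝ) (P : BeurlingPrimes) : ℂ := Complex.exp (Z f g P 1)

/-- The regular part `H = dslope (s e^{Z(s)}) 1`, i.e. `G(s) − a/(s−1)` off `s = 1`. [cite: BrouckeVindas2024, proof of Theorem 3.1] -/
def H (f g : ℝ → ℝ) (P : BeurlingPrimes) : ℂ → ℂ := dslope (num f g P) 1

/-- The half-plane `U = {σ > 1/2}` is open (private copy of a folklore lemma). [folklore] -/
private theorem isOpen_U : IsOpen {s : ℂ | 1 / 2 < s.re} := isOpen_lt continuous_const Complex.continuous_re

/-- `ζ_P = G` on `σ > 1`. [cite: BrouckeVindas2024, proof of Theorem 3.1] -/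
theorem PerronHyp.zeta_eq (h : PerronHyp f g P A K) {s : ℂ} (hs : 1 < s.re) : P.zeta s = contZeta f g P s := by
  rw [zeta_eq_exp_mul_exp_Z h.approx h.fm h.fb h.gm h.gf hs, h.g1 s hs, contZeta]

/-- `num` is holomorphic on `U`. [cite: BrouckeVindas2024, proof of Theorem 3.1] -/
theorem PerronHyp.differentiableOn_num (h : PerronHyp f g P A K) :
    DifferentiableOn ℂ (num f g P) {s : ℂ | 1 / 2 < s.re} :=
  differentiableOn_id.mul (differentiableOn_Z h.approx h.fm h.fb h.gm h.gf).cexp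

/-- `H` is holomorphic on `U`. [cite: BrouckeVindas2024, proof of Theorem 3.1] -/
theorem PerronHyp.differentiableOn_H (h : PerronHyp f g P A K) :
    DifferentiableOn ℂ (H f g P) {s : ℂ | 1 / 2 < s.re} :=
  (Complex.differentiableOn_dslope (isOpen_U.mem_nhds (by norm_num : (1 : ℝ) / 2 < (1 : ℂ).re))).mpr
    h.differentiableOn_num

/-- `G` is holomorphic on `U ∖ {1}`. [cite: BrouckeVindas2024, proof of Theorem 3.1] -/
theorem PerronHyp.differentiableAt_contZeta (h : PerronHyp f g P A K) {s : ℂ} (hs : 1 / 2 < s.re) (hs1 : s ≠ 1) :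
    DifferentiableAt ℂ (contZeta f g P) s := by
  have hZ : DifferentiableAt ℂ (Z f g P) s :=
    (differentiableOn_Z h.approx h.fm h.fb h.gm h.gf).differentiableAt (isOpen_U.mem_nhds hs)
  have h1 : DifferentiableAt ℂ (fun s : ℂ ↦ s / (s - 1)) s :=
    differentiableAt_id.div (differentiableAt_id.sub (differentiableAt_const 1)) (sub_ne_zero.mpr hs1)
  unfold contZeta
  exact h1.mul hZ.cexp

/-- Off `s = 1`: `H(s) = G(s) − a/(s−1)`. [cite: BrouckeVindas2024, proof of Theorem 3.1] -/
theorem H_eq {s : ℂ} (hs : s ≠ 1) : H f g P s = contZeta f g P s - res f g P / (s - 1) := by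
  rw [H, dslope_of_ne _ hs, slope_def_field, res, num, num, contZeta, one_mul]
  have h1 : s - 1 ≠ 0 := sub_ne_zero.mpr hs
  field_simp

/-- Off `s = 1`: `G = polePart {1} a + H`. [cite: BrouckeVindas2024, proof of Theorem 3.1] -/
theorem contZeta_eq_polePart_add_H {s : ℂ} (hs : s ≠ 1) :
    contZeta f g P s = polePart {1} (fun _ ↦ res f g P) s + H f g P s := by
  rw [H_eq hs, polePart, Finset.sum_singleton]
  push_cast
  ring

/-! ### The residue is a positive real -/

/-- A complex limit of non-negative reals is a non-negative real. [folklore] -/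
private theorem mem_of_tendsto_nonneg_real' {F : ℝ → ℂ} {l : Filter ℝ} [l.NeBot] {κ : ℂ}
    (h : Tendsto F l (𝓝 κ)) (hf : ∀ᶠ x in l, (F x).im = 0 ∧ 0 ≤ (F x).re) : κ.im = 0 ∧ 0 ≤ κ.re := by
  have hS : IsClosed {z : ℂ | z.im = 0 ∧ 0 ≤ z.re} :=
    (isClosed_eq Complex.continuous_im continuous_const).inter (isClosed_le continuous_const Complex.continuous_re)
  exact hS.mem_of_tendsto h hf

/-- `ζ_P(σ)` is a non-negative real for real `σ` (a `tsum` of positive reals). [folklore] -/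
private theorem zeta_ofReal_mem' (Q : BeurlingPrimes) (σ : ℝ) : (Q.zeta σ).im = 0 ∧ 0 ≤ (Q.zeta σ).re := by
  have h : Q.zeta σ = ((∑' k : ℕ →₀ ℕ, Q.genInt k ^ (-σ) : ℝ) : ℂ) := by
    rw [BeurlingPrimes.zeta, Complex.ofReal_tsum]
    refine tsum_congr fun k ↦ ?_
    rw [Complex.ofReal_cpow (Q.one_le_genInt k |> le_trans zero_le_one)]
    push_cast
    ring_nf
  rw [h, ofReal_im, ofReal_re]
  exact ⟨rfl, tsum_nonneg fun k ↦ Real.rpow_nonneg (le_trans zero_le_one (Q.one_le_genInt k)) _⟩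

/-- `(σ − 1) ζ_P(σ) → a` as `σ → 1⁺` (indeed `(σ−1)ζ_P(σ) = σ e^{Z(σ)}`). [cite: BrouckeVindas2024, proof of Theorem 3.1] -/
theorem PerronHyp.tendsto_sub_one_mul_zeta (h : PerronHyp f g P A K) :
    Tendsto (fun σ : ℝ ↦ ((σ : ℂ) - 1) * P.zeta σ) (𝓝[>] 1) (𝓝 (res f g P)) := by
  have hcont : ContinuousAt (num f g P) 1 :=
    (h.differentiableOn_num.differentiableAt (isOpen_U.mem_nhds (by norm_num))).continuousAt
  have hof : Tendsto (fun σ : ℝ ↦ (σ : ℂ)) (𝓝[>] (1 : ℝ)) (𝓝 (1 : ℂ)) :=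
    (Complex.continuous_ofReal.tendsto' 1 1 (by simp)).mono_left nhdsWithin_le_nhds
  have hn1 : num f g P 1 = res f g P := by simp [num, res]
  have h1 : Tendsto (fun σ : ℝ ↦ num f g P σ) (𝓝[>] (1 : ℝ)) (𝓝 (res f g P)) := by
    have := hcont.tendsto.comp hof
    rw [hn1] at this
    exact this
  refine h1.congr' ?_
  refine eventually_nhdsWithin_of_forall fun σ hσ ↦ ?_
  have hσ1 : (1 : ℝ) < σ := hσ
  have hne : (σ : ℂ) - 1 ≠ 0 := by
    intro h0; have := congrArg Complex.re h0; simp at this; linarith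
  show num f g P σ = ((σ : ℂ) - 1) * P.zeta σ
  rw [h.zeta_eq (by simpa using hσ1), contZeta, num]
  field_simp

/-- **`a` is a positive real number**: `Im a = 0`, `Re a > 0`. [cite: BrouckeVindas2024, proof of Theorem 3.1] -/
theorem PerronHyp.res_real_pos (h : PerronHyp f g P A K) : (res f g P).im = 0 ∧ 0 < (res f g P).re := by
  have hne : res f g P ≠ 0 := Complex.exp_ne_zero _
  have hreal : (res f g P).im = 0 ∧ 0 ≤ (res f g P).re := by
    refine mem_of_tendsto_nonneg_real' h.tendsto_sub_one_mul_zeta ?_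
    refine eventually_nhdsWithin_of_forall fun σ hσ ↦ ?_
    have hσ1 : (1 : ℝ) < σ := hσ
    obtain ⟨him, hre⟩ := zeta_ofReal_mem' P σ
    have hsub : ((σ : ℂ) - 1) = ((σ - 1 : ℝ) : ℂ) := by push_cast; ring
    rw [hsub, Complex.re_ofReal_mul, Complex.im_ofReal_mul, him, mul_zero]
    exact ⟨rfl, mul_nonneg (by linarith) hre⟩
  refine ⟨hreal.1, lt_of_le_of_ne hreal.2 fun h0 ↦ hne (Complex.ext ?_ ?_)⟩
  · simp [← h0]
  · simp [hreal.1]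

/-- `a` as a complex number is the real number `Re a`. [cite: BrouckeVindas2024, proof of Theorem 3.1] -/
theorem PerronHyp.res_eq_ofReal (h : PerronHyp f g P A K) : res f g P = ((res f g P).re : ℂ) :=
  Complex.ext (by simp) (by simp [h.res_real_pos.1])

/-! ### The bound `‖G(u + iT)‖ ≤ B_η(|T|)` -/

/-- The constant `C = C(A, K, λ₀)` of (3.2) (`BVContinuation.norm_Z_le`). [cite: BrouckeVindas2024, proof of Theorem 3.1 (3.2)] -/
def CZ (P : BeurlingPrimes) (A K : ℝ) : ℝ :=
  2 * (((1 - P.prime 0 ^ (-(1 / 2 : ℝ)))⁻¹ / 2) * (2 + A) ^ (4 : ℝ)) + 2 * A + K + 2 * A * Real.sqrt π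

/-- `C ≥ 0`. [cite: BrouckeVindas2024, proof of Theorem 3.1] -/
theorem PerronHyp.CZ_nonneg (h : PerronHyp f g P A K) : 0 ≤ CZ P A K := by
  have hA := h.approx.nonneg
  have hK := cmpConst_nonneg h.gf
  have hK₀ := E₁const_nonneg P
  unfold CZ
  positivity

/-- (3.2) restated with the constant `CZ`. [cite: BrouckeVindas2024, proof of Theorem 3.1 (3.2)] -/
theorem PerronHyp.norm_Z_le' (h : PerronHyp f g P A K) {s : ℂ} (hs : 1 / 2 < s.re) (hs2 : s.re ≤ 2) :
    ‖Z f g P s‖ ≤ CZ P A K * (1 / (s.re - 1 / 2) + Real.sqrt (Real.log (|s.im| + 1)) / Real.sqrt (s.re - 1 / 2)) :=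
  norm_Z_le h.approx h.fm h.fb h.gm h.gf hs hs2

/-- The majorant `B_η(t) = 8 e^{C/η} e^{(C/√η) √log(t+1)}` on the strip `σ ≥ 1/2 + η`
("uniformly for `σ ≥ σ_x`, `|Z(s)| ≤ C((log x)^{1/3} + (log x)^{1/6}√log(|t|+1))`", `η = (log x)^{−1/3}`).
[cite: BrouckeVindas2024, proof of Theorem 3.1] -/
def Bmaj (C η t : ℝ) : ℝ :=
  8 * Real.exp (C / η) * Real.exp (C / Real.sqrt η * Real.sqrt (Real.log (max t 0 + 1)))

/-- `B_η ≥ 0`. [cite: BrouckeVindas2024, proof of Theorem 3.1] -/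
theorem Bmaj_nonneg (C η t : ℝ) : 0 ≤ Bmaj C η t := by unfold Bmaj; positivity

/-- `B_η` is non-decreasing (for `C ≥ 0`, `η > 0`). [cite: BrouckeVindas2024, proof of Theorem 3.1] -/
theorem Bmaj_mono {C η : ℝ} (hC : 0 ≤ C) (hη : 0 < η) : Monotone (Bmaj C η) := by
  intro t₁ t₂ ht
  unfold Bmaj
  refine mul_le_mul_of_nonneg_left (Real.exp_le_exp.mpr ?_) (by positivity)
  refine mul_le_mul_of_nonneg_left (Real.sqrt_le_sqrt ?_) (by positivity)
  exact Real.log_le_log (by positivity) (by linarith [max_le_max ht (le_refl (0 : ℝ))])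

/-- `B_η` at `|T|`: the `max` disappears. [cite: BrouckeVindas2024, proof of Theorem 3.1] -/
theorem Bmaj_abs (C η T : ℝ) :
    Bmaj C η |T| = 8 * Real.exp (C / η) * Real.exp (C / Real.sqrt η * Real.sqrt (Real.log (|T| + 1))) := by
  rw [Bmaj, max_eq_left (abs_nonneg T)]

/-- `‖s/(s−1)‖ ≤ 5` as soon as `‖s − 1‖ ≥ 1/4`. [folklore] -/
theorem norm_div_sub_one_le {s : ℂ} (hd : 1 / 4 ≤ ‖s - 1‖) : ‖s / (s - 1)‖ ≤ 5 := by
  have hs1 : s - 1 ≠ 0 := by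
    intro h0; rw [h0, norm_zero] at hd; norm_num at hd
  have hpos : 0 < ‖s - 1‖ := norm_pos_iff.mpr hs1
  rw [norm_div, div_le_iff₀ hpos]
  have : ‖s‖ ≤ ‖s - 1‖ + 1 := by
    calc ‖s‖ = ‖(s - 1) + 1‖ := by rw [sub_add_cancel]
      _ ≤ ‖s - 1‖ + ‖(1 : ℂ)‖ := norm_add_le _ _
      _ = ‖s - 1‖ + 1 := by rw [norm_one]
  nlinarith

/-- **`‖G(s)‖ ≤ B_η(|Im s|)`** for `1/2 + η ≤ Re s ≤ 3/2` (`0 < η ≤ 1`) and `‖s − 1‖ ≥ 1/4`: from (3.2),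
`‖e^{Z(s)}‖ ≤ e^{C/η} e^{(C/√η)√log(|t|+1)}` and `‖s/(s−1)‖ ≤ 5`. [cite: BrouckeVindas2024, proof of Theorem 3.1] -/
theorem PerronHyp.norm_contZeta_le (h : PerronHyp f g P A K) {η : ℝ} (hη : 0 < η) {s : ℂ}
    (hs : 1 / 2 + η ≤ s.re) (hs2 : s.re ≤ 3 / 2) (hd : 1 / 4 ≤ ‖s - 1‖) :
    ‖contZeta f g P s‖ ≤ Bmaj (CZ P A K) η |s.im| := by
  have hratio := norm_div_sub_one_le hd
  have hσ : 1 / 2 < s.re := by linarith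
  have hZ := h.norm_Z_le' hσ (by linarith)
  set C := CZ P A K with hCdef
  have hC : 0 ≤ C := h.CZ_nonneg
  set ℓ := Real.log (|s.im| + 1) with hℓdef
  have h1 : 1 / (s.re - 1 / 2) ≤ 1 / η := one_div_le_one_div_of_le hη (by linarith)
  have h2 : Real.sqrt ℓ / Real.sqrt (s.re - 1 / 2) ≤ Real.sqrt ℓ / Real.sqrt η :=
    div_le_div_of_nonneg_left (Real.sqrt_nonneg _) (Real.sqrt_pos.mpr hη) (Real.sqrt_le_sqrt (by linarith))
  have hZ' : ‖Z f g P s‖ ≤ C / η + C / Real.sqrt η * Real.sqrt ℓ := by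
    calc ‖Z f g P s‖ ≤ C * (1 / (s.re - 1 / 2) + Real.sqrt ℓ / Real.sqrt (s.re - 1 / 2)) := hZ
      _ ≤ C * (1 / η + Real.sqrt ℓ / Real.sqrt η) := mul_le_mul_of_nonneg_left (add_le_add h1 h2) hC
      _ = C / η + C / Real.sqrt η * Real.sqrt ℓ := by ring
  have hexp : ‖Complex.exp (Z f g P s)‖ ≤ Real.exp (C / η) * Real.exp (C / Real.sqrt η * Real.sqrt ℓ) := by
    rw [Complex.norm_exp, ← Real.exp_add]
    exact Real.exp_le_exp.mpr ((Complex.re_le_norm _).trans hZ')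
  have hE : 0 ≤ Real.exp (C / η) * Real.exp (C / Real.sqrt η * Real.sqrt ℓ) := by positivity
  rw [Bmaj_abs, contZeta, norm_mul]
  calc ‖s / (s - 1)‖ * ‖Complex.exp (Z f g P s)‖
      ≤ 5 * (Real.exp (C / η) * Real.exp (C / Real.sqrt η * Real.sqrt ℓ)) :=
        mul_le_mul hratio hexp (norm_nonneg _) (by norm_num)
    _ ≤ 8 * (Real.exp (C / η) * Real.exp (C / Real.sqrt η * Real.sqrt ℓ)) := by nlinarith
    _ = 8 * Real.exp (C / η) * Real.exp (C / Real.sqrt η * Real.sqrt ℓ) := by ring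

/-- On a vertical line `Re s = σ` with `1/2 < σ`, `σ ≠ 1`, `t ↦ G(σ+it)` is continuous.
[cite: BrouckeVindas2024, proof of Theorem 3.1] -/
theorem PerronHyp.continuous_contZeta_vertical (h : PerronHyp f g P A K) {σ : ℝ} (hσ : 1 / 2 < σ) (hσ1 : σ ≠ 1) :
    Continuous fun t : ℝ ↦ contZeta f g P ((σ : ℂ) + t * I) := by
  refine continuous_iff_continuousAt.2 fun t ↦ ?_
  have hs : 1 / 2 < ((σ : ℂ) + t * I).re := by simpa using hσ
  have hs1 : (σ : ℂ) + t * I ≠ 1 := by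
    intro h0; have := congrArg Complex.re h0; simp at this; exact hσ1 this
  exact (h.differentiableAt_contZeta hs hs1).continuousAt.comp (f := fun t : ℝ ↦ (σ : ℂ) + t * I) (by fun_prop)

/-! ### Elementary exponential bounds -/

/-- `e^{b√L} ≤ e^{b²/(4δ)} e^{δL}` for `L ≥ 0`, `δ > 0` (`b√L ≤ δL + b²/(4δ)`; private copy of the tree's
`DMV.exp_mul_sqrt_le`, `DMVIntegerCount.lean`, to keep the import closure small). [folklore] -/
private theorem exp_mul_sqrt_le' (b : ℝ) {L δ : ℝ} (hL : 0 ≤ L) (hδ : 0 < δ) :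
    Real.exp (b * Real.sqrt L) ≤ Real.exp (b ^ 2 / (4 * δ)) * Real.exp (δ * L) := by
  rw [← Real.exp_add]
  refine Real.exp_le_exp.mpr ?_
  have hs : Real.sqrt L ^ 2 = L := Real.sq_sqrt hL
  have h0 : 0 ≤ (2 * δ * Real.sqrt L - b) ^ 2 := sq_nonneg _
  have hs2 : δ ^ 2 * Real.sqrt L ^ 2 = δ ^ 2 * L := by rw [hs]
  have h1 : 4 * δ * (b * Real.sqrt L) ≤ b ^ 2 + 4 * δ ^ 2 * L := by nlinarith [h0, hs2]
  have h4δ : 0 < 4 * δ := by linarith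
  rw [div_add' _ _ _ h4δ.ne', le_div_iff₀ h4δ]
  linarith [h1]

/-- `B_η(T)/T² → 0` (indeed `B_η(T) ≪ (T+1)^{1/2}`). [cite: BrouckeVindas2024, proof of Theorem 3.1] -/
theorem tendsto_Bmaj_div_sq (C η : ℝ) : Tendsto (fun T : ℝ ↦ Bmaj C η T / T ^ 2) atTop (𝓝 0) := by
  set b : ℝ := C / Real.sqrt η with hb
  set M : ℝ := 8 * Real.exp (C / η) * Real.exp (b ^ 2 / (4 * (1 / 2))) with hM
  have hM0 : 0 ≤ M := by positivity
  -- `Bmaj ≤ M (T+1)^{1/2}` for `T ≥ 0`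
  have hle : ∀ T : ℝ, 0 ≤ T → Bmaj C η T ≤ M * (T + 1) ^ (1 / 2 : ℝ) := by
    intro T hT
    have hL : 0 ≤ Real.log (T + 1) := Real.log_nonneg (by linarith)
    have h := exp_mul_sqrt_le' b hL (by norm_num : (0:ℝ) < 1 / 2)
    have hpow : Real.exp (1 / 2 * Real.log (T + 1)) = (T + 1) ^ (1 / 2 : ℝ) := by
      rw [Real.rpow_def_of_pos (by linarith), mul_comm]
    rw [hpow] at h
    rw [Bmaj, max_eq_left hT, hM]
    calc 8 * Real.exp (C / η) * Real.exp (b * Real.sqrt (Real.log (T + 1)))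
        ≤ 8 * Real.exp (C / η) * (Real.exp (b ^ 2 / (4 * (1 / 2))) * (T + 1) ^ (1 / 2 : ℝ)) :=
          mul_le_mul_of_nonneg_left h (by positivity)
      _ = 8 * Real.exp (C / η) * Real.exp (b ^ 2 / (4 * (1 / 2))) * (T + 1) ^ (1 / 2 : ℝ) := by ring
  -- `(T+1)^{1/2}/T² ≤ √2 T^{−3/2}` for `T ≥ 1`
  have hmaj : Tendsto (fun T : ℝ ↦ M * (Real.sqrt 2 * T ^ (-(3 / 2 : ℝ)))) atTop (𝓝 0) := by
    have := ((tendsto_rpow_neg_atTop (show (0:ℝ) < 3 / 2 by norm_num)).const_mul (Real.sqrt 2)).const_mul M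
    simpa using this
  refine squeeze_zero' ?_ ?_ hmaj
  · filter_upwards [eventually_ge_atTop (0 : ℝ)] with T hT
    exact div_nonneg (Bmaj_nonneg C η T) (sq_nonneg T)
  · filter_upwards [eventually_ge_atTop (1 : ℝ)] with T hT
    have hT0 : 0 < T := by linarith
    rw [div_le_iff₀ (by positivity)]
    calc Bmaj C η T ≤ M * (T + 1) ^ (1 / 2 : ℝ) := hle T hT0.le
      _ ≤ M * (2 * T) ^ (1 / 2 : ℝ) :=
          mul_le_mul_of_nonneg_left (Real.rpow_le_rpow (by linarith) (by linarith) (by norm_num)) hM0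
      _ = M * (Real.sqrt 2 * T ^ (-(3 / 2 : ℝ))) * T ^ 2 := by
          rw [Real.mul_rpow (by norm_num) hT0.le, Real.sqrt_eq_rpow]
          have : T ^ (1 / 2 : ℝ) = T ^ (-(3 / 2 : ℝ)) * T ^ 2 := by
            rw [← Real.rpow_natCast T 2, ← Real.rpow_add hT0]; norm_num
          rw [this]; ring

/-! ### The parameters `L = log x`, `η = L^{−1/3}`, `σ_x = 1/2 + η` -/

/-- `η(x) = (log x)^{−1/3}`. [cite: BrouckeVindas2024, proof of Theorem 3.1 ("σ_x = 1/2 + (log x)^{−1/3}")] -/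
def eta (x : ℝ) : ℝ := Real.log x ^ (-(1 / 3 : ℝ))

section EtaFacts

variable {x : ℝ} (hx : Real.exp 64 ≤ x)
include hx

/-- `x > 0`. [folklore] -/
theorem x_pos : 0 < x := lt_of_lt_of_le (Real.exp_pos 64) hx

/-- `64 ≤ log x`. [folklore] -/
theorem log_ge : 64 ≤ Real.log x := by
  have := Real.log_le_log (Real.exp_pos 64) hx
  rwa [Real.log_exp] at this

/-- `0 < η`. [folklore] -/
theorem eta_pos : 0 < eta x := Real.rpow_pos_of_pos (by linarith [log_ge hx]) _

/-- `1/η = L^{1/3}`. [folklore] -/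
theorem one_div_eta : 1 / eta x = Real.log x ^ (1 / 3 : ℝ) := by
  have hL0 : 0 < Real.log x := by linarith [log_ge hx]
  rw [eta, Real.rpow_neg hL0.le, one_div, inv_inv]

/-- `η ≤ 1/4` (`L^{1/3} ≥ 4`). [folklore] -/
theorem eta_le : eta x ≤ 1 / 4 := by
  have hL := log_ge hx
  have h13 : (4 : ℝ) ≤ Real.log x ^ (1 / 3 : ℝ) := by
    calc (4 : ℝ) = ((4 : ℝ) ^ (3 : ℝ)) ^ (1 / 3 : ℝ) := by rw [← Real.rpow_mul (by norm_num)]; norm_num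
      _ ≤ Real.log x ^ (1 / 3 : ℝ) := Real.rpow_le_rpow (by norm_num) (by norm_num; linarith) (by norm_num)
  have h : eta x = 1 / Real.log x ^ (1 / 3 : ℝ) := by rw [← one_div_eta hx, one_div_one_div]
  rw [h]
  exact div_le_div_of_nonneg_left zero_le_one (by norm_num) h13

/-- `1/√η = L^{1/6}`. [folklore] -/
theorem one_div_sqrt_eta : 1 / Real.sqrt (eta x) = Real.log x ^ (1 / 6 : ℝ) := by
  have hL0 : 0 < Real.log x := by linarith [log_ge hx]
  rw [eta, Real.sqrt_eq_rpow, ← Real.rpow_mul hL0.le, one_div, ← Real.rpow_neg hL0.le]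
  norm_num

/-- `η L = L^{2/3}`. [folklore] -/
theorem eta_mul_log : eta x * Real.log x = Real.log x ^ (2 / 3 : ℝ) := by
  have hL0 : 0 < Real.log x := by linarith [log_ge hx]
  calc eta x * Real.log x = Real.log x ^ (-(1 / 3 : ℝ)) * Real.log x ^ (1 : ℝ) := by
        rw [Real.rpow_one]; rfl
    _ = Real.log x ^ (2 / 3 : ℝ) := by rw [← Real.rpow_add hL0]; norm_num

/-- `x^η = e^{L^{2/3}}`. [folklore] -/
theorem rpow_eta : x ^ eta x = Real.exp (Real.log x ^ (2 / 3 : ℝ)) := by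
  rw [Real.rpow_def_of_pos (x_pos hx), mul_comm, eta_mul_log hx]

/-- `L^{1/3} ≤ L^{2/3}` and `1 ≤ L^{2/3}`. [folklore] -/
theorem log_rpow_facts : Real.log x ^ (1 / 3 : ℝ) ≤ Real.log x ^ (2 / 3 : ℝ) ∧ 1 ≤ Real.log x ^ (2 / 3 : ℝ) := by
  have hL1 : 1 ≤ Real.log x := by linarith [log_ge hx]
  exact ⟨Real.rpow_le_rpow_of_exponent_le hL1 (by norm_num), Real.one_le_rpow hL1 (by norm_num)⟩

/-- `log x ≤ e^{(3/2) L^{2/3}}` (`log L = (3/2) log L^{2/3} ≤ (3/2) L^{2/3}`). [folklore] -/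
theorem log_le_exp : Real.log x ≤ Real.exp (3 / 2 * Real.log x ^ (2 / 3 : ℝ)) := by
  have hL0 : 0 < Real.log x := by linarith [log_ge hx]
  set L := Real.log x
  have hz : 0 < L ^ (2 / 3 : ℝ) := Real.rpow_pos_of_pos hL0 _
  have h1 : Real.log L = 3 / 2 * Real.log (L ^ (2 / 3 : ℝ)) := by
    rw [Real.log_rpow hL0]; ring
  have h2 : Real.log (L ^ (2 / 3 : ℝ)) ≤ L ^ (2 / 3 : ℝ) := (Real.log_le_sub_one_of_pos hz).trans (by linarith)
  calc L = Real.exp (Real.log L) := (Real.exp_log hL0).symm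
    _ ≤ Real.exp (3 / 2 * L ^ (2 / 3 : ℝ)) := Real.exp_le_exp.mpr (by rw [h1]; nlinarith)

/-- `log(x+1) ≤ 2 log x` and `log(2x+1) ≤ 2 log x` (`x ≥ 3`). [folklore] -/
theorem log_succ_le : Real.log (x + 1) ≤ 2 * Real.log x ∧ Real.log (2 * x + 1) ≤ 2 * Real.log x := by
  have hx0 := x_pos hx
  have hx3 : 3 ≤ x := le_trans (by have := Real.add_one_le_exp (64:ℝ); linarith) hx
  have h2 : 2 * Real.log x = Real.log (x ^ 2) := by rw [Real.log_pow]; push_cast; ring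
  rw [h2]
  constructor
  · exact Real.log_le_log (by linarith) (by nlinarith)
  · exact Real.log_le_log (by linarith) (by nlinarith)

end EtaFacts

/-! ### The estimates of the shifted integral -/

/-- The exponent constant `c = 5/2 + 3C + C²/4`. [cite: BrouckeVindas2024, proof of Theorem 3.1 ("any c > 2C + 1")] -/
def cexpo (C : ℝ) : ℝ := 5 / 2 + 3 * C + C ^ 2 / 4

/-- `∫_{(0,x]} dt/(t + 1/2) = log(2x+1)`. [folklore] -/
theorem integral_inv_add_half {x : ℝ} (hx : 0 < x) : ∫ t in Ioc 0 x, (t + 1 / 2)⁻¹ = Real.log (2 * x + 1) := by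
  rw [← intervalIntegral.integral_of_le hx.le,
    intervalIntegral.integral_comp_add_right (fun u : ℝ ↦ u⁻¹) (1 / 2 : ℝ), zero_add,
    integral_inv_of_pos (by norm_num) (by linarith)]
  congr 1
  field_simp

/-- **First piece (`|t| ≤ x`)**: `4 y₂^{σ_x} ∫₀ˣ B_η(t)/(σ_x + t) dt ≤ 256 x^{1/2} e^{c L^{2/3}}` for `y₂ ≤ x + 1`,
`x ≥ e^{64}` (`B_η(t) ≤ B_η(x) ≤ 8e^{3C L^{2/3}}`, `∫₀ˣ dt/(1/2+t) = log(2x+1) ≤ 2L ≤ 2e^{(3/2)L^{2/3}}`,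
`y₂^{σ_x} ≤ 2x^{1/2} e^{L^{2/3}}`). [cite: BrouckeVindas2024, proof of Theorem 3.1] -/
theorem first_piece_le {C x y₂ : ℝ} (hC : 0 ≤ C) (hx : Real.exp 64 ≤ x) (hy₂ : 0 < y₂) (hy₂x : y₂ ≤ x + 1) :
    4 * y₂ ^ (1 / 2 + eta x) * ∫ t in Ioc 0 x, Bmaj C (eta x) t / (1 / 2 + eta x + t) ≤
      256 * (x ^ (1 / 2 : ℝ) * Real.exp (cexpo C * Real.log x ^ (2 / 3 : ℝ))) := by
  have hx0 := x_pos hx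
  have hx1 : 1 ≤ x := le_trans (by have := Real.add_one_le_exp (64:ℝ); linarith) hx
  have hη := eta_pos hx
  have hη4 := eta_le hx
  have hL0 : 0 < Real.log x := by linarith [log_ge hx]
  obtain ⟨h13, hE1⟩ := log_rpow_facts hx
  have hBm := Bmaj_mono hC hη
  -- (1) `∫ B/(σ_x+t) ≤ B(x) log(2x+1)`
  have hinteg : IntegrableOn (fun t : ℝ ↦ (t + 1 / 2)⁻¹) (Ioc 0 x) := by
    refine (ContinuousOn.integrableOn_compact isCompact_Icc ?_).mono_set Ioc_subset_Icc_self
    refine continuousOn_of_forall_continuousAt fun t ht ↦ ?_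
    exact (continuousAt_id.add continuousAt_const).inv₀ (by have : (0:ℝ) ≤ t := ht.1; simp; linarith)
  have hpt : ∀ t ∈ Ioc (0 : ℝ) x, Bmaj C (eta x) t / (1 / 2 + eta x + t) ≤ Bmaj C (eta x) x * (t + 1 / 2)⁻¹ := by
    intro t ht
    have ht0 : 0 < t := ht.1
    rw [div_eq_mul_inv]
    exact mul_le_mul (hBm ht.2) ((inv_le_inv₀ (by linarith) (by linarith)).mpr (by linarith))
      (inv_nonneg.mpr (by linarith)) (Bmaj_nonneg _ _ _)
  have hI : ∫ t in Ioc 0 x, Bmaj C (eta x) t / (1 / 2 + eta x + t) ≤ Bmaj C (eta x) x * Real.log (2 * x + 1) := by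
    calc ∫ t in Ioc 0 x, Bmaj C (eta x) t / (1 / 2 + eta x + t)
        ≤ ∫ t in Ioc 0 x, Bmaj C (eta x) x * (t + 1 / 2)⁻¹ := by
          refine setIntegral_mono_on ?_ (hinteg.const_mul _) measurableSet_Ioc hpt
          refine Integrable.mono' (hinteg.const_mul (Bmaj C (eta x) x)) ?_ ?_
          · exact (hBm.measurable.div (measurable_const.add measurable_id)).aestronglyMeasurable
          · rw [ae_restrict_iff' measurableSet_Ioc]
            refine Eventually.of_forall fun t ht ↦ ?_
            rw [Real.norm_eq_abs, abs_of_nonneg (div_nonneg (Bmaj_nonneg _ _ _) (by linarith [ht.1]))]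
            exact hpt t ht
      _ = Bmaj C (eta x) x * Real.log (2 * x + 1) := by
          rw [MeasureTheory.integral_const_mul, integral_inv_add_half hx0]
  -- (2) `B(x) ≤ 8 e^{3 C L^{2/3}}`
  have hBx : Bmaj C (eta x) x ≤ 8 * Real.exp (3 * C * Real.log x ^ (2 / 3 : ℝ)) := by
    rw [Bmaj, max_eq_left hx0.le]
    have hlog1 : Real.sqrt (Real.log (x + 1)) ≤ Real.sqrt 2 * Real.sqrt (Real.log x) := by
      rw [← Real.sqrt_mul (by norm_num)]
      exact Real.sqrt_le_sqrt (log_succ_le hx).1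
    have h1 : C / eta x = C * Real.log x ^ (1 / 3 : ℝ) := by rw [div_eq_mul_one_div, one_div_eta hx]
    have h2 : C / Real.sqrt (eta x) * Real.sqrt (Real.log (x + 1)) ≤ Real.sqrt 2 * C * Real.log x ^ (2 / 3 : ℝ) := by
      calc C / Real.sqrt (eta x) * Real.sqrt (Real.log (x + 1))
          ≤ C / Real.sqrt (eta x) * (Real.sqrt 2 * Real.sqrt (Real.log x)) :=
            mul_le_mul_of_nonneg_left hlog1 (by positivity)
        _ = Real.sqrt 2 * C * (Real.log x ^ (1 / 6 : ℝ) * Real.log x ^ (1 / 2 : ℝ)) := by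
            rw [div_eq_mul_one_div, one_div_sqrt_eta hx, Real.sqrt_eq_rpow (Real.log x)]; ring
        _ = Real.sqrt 2 * C * Real.log x ^ (2 / 3 : ℝ) := by
            rw [← Real.rpow_add hL0]; norm_num
    have hs2 : Real.sqrt 2 ≤ 2 := by
      rw [Real.sqrt_le_left (by norm_num)]; norm_num
    have hCE : 0 ≤ C * Real.log x ^ (2 / 3 : ℝ) := mul_nonneg hC (le_trans zero_le_one hE1)
    have h3 : C / eta x + C / Real.sqrt (eta x) * Real.sqrt (Real.log (x + 1)) ≤ 3 * C * Real.log x ^ (2 / 3 : ℝ) := by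
      rw [h1]
      have : C * Real.log x ^ (1 / 3 : ℝ) ≤ C * Real.log x ^ (2 / 3 : ℝ) := mul_le_mul_of_nonneg_left h13 hC
      nlinarith
    rw [mul_assoc, ← Real.exp_add]
    exact mul_le_mul_of_nonneg_left (Real.exp_le_exp.mpr h3) (by norm_num)
  -- (3) `log(2x+1) ≤ 2 e^{(3/2) L^{2/3}}` and `y₂^{σ_x} ≤ 2 x^{1/2} e^{L^{2/3}}`
  have hlog2 : Real.log (2 * x + 1) ≤ 2 * Real.exp (3 / 2 * Real.log x ^ (2 / 3 : ℝ)) := by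
    linarith [(log_succ_le hx).2, log_le_exp hx]
  have hy : y₂ ^ (1 / 2 + eta x) ≤ 2 * (x ^ (1 / 2 : ℝ) * Real.exp (Real.log x ^ (2 / 3 : ℝ))) := by
    have hσ1 : 1 / 2 + eta x ≤ 1 := by linarith
    calc y₂ ^ (1 / 2 + eta x) ≤ (2 * x) ^ (1 / 2 + eta x) := Real.rpow_le_rpow hy₂.le (by linarith) (by linarith)
      _ = 2 ^ (1 / 2 + eta x) * (x ^ (1 / 2 : ℝ) * x ^ eta x) := by
          rw [Real.mul_rpow (by norm_num) hx0.le, Real.rpow_add hx0]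
      _ ≤ 2 * (x ^ (1 / 2 : ℝ) * Real.exp (Real.log x ^ (2 / 3 : ℝ))) := by
          rw [rpow_eta hx]
          refine mul_le_mul ?_ le_rfl (by positivity) (by norm_num)
          calc (2 : ℝ) ^ (1 / 2 + eta x) ≤ 2 ^ (1 : ℝ) := Real.rpow_le_rpow_of_exponent_le (by norm_num) hσ1
            _ = 2 := Real.rpow_one 2
  -- (4) assemble
  have hlogpos : 0 ≤ Real.log (2 * x + 1) := Real.log_nonneg (by linarith)
  have hprod : Bmaj C (eta x) x * Real.log (2 * x + 1) ≤
      8 * Real.exp (3 * C * Real.log x ^ (2 / 3 : ℝ)) * (2 * Real.exp (3 / 2 * Real.log x ^ (2 / 3 : ℝ))) :=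
    mul_le_mul hBx hlog2 hlogpos (by positivity)
  have hexp : Real.exp (Real.log x ^ (2 / 3 : ℝ)) * (Real.exp (3 * C * Real.log x ^ (2 / 3 : ℝ)) *
      Real.exp (3 / 2 * Real.log x ^ (2 / 3 : ℝ))) = Real.exp ((5 / 2 + 3 * C) * Real.log x ^ (2 / 3 : ℝ)) := by
    rw [← Real.exp_add, ← Real.exp_add]; congr 1; ring
  have hcle : Real.exp ((5 / 2 + 3 * C) * Real.log x ^ (2 / 3 : ℝ)) ≤ Real.exp (cexpo C * Real.log x ^ (2 / 3 : ℝ)) := by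
    refine Real.exp_le_exp.mpr (mul_le_mul_of_nonneg_right ?_ (le_trans zero_le_one hE1))
    unfold cexpo; nlinarith [sq_nonneg C]
  have hIn : 0 ≤ ∫ t in Ioc 0 x, Bmaj C (eta x) t / (1 / 2 + eta x + t) :=
    setIntegral_nonneg measurableSet_Ioc fun t ht ↦ div_nonneg (Bmaj_nonneg _ _ _) (by linarith [ht.1])
  have hxh : 0 ≤ x ^ (1 / 2 : ℝ) := Real.rpow_nonneg hx0.le _
  calc 4 * y₂ ^ (1 / 2 + eta x) * ∫ t in Ioc 0 x, Bmaj C (eta x) t / (1 / 2 + eta x + t)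
      ≤ 4 * (2 * (x ^ (1 / 2 : ℝ) * Real.exp (Real.log x ^ (2 / 3 : ℝ)))) *
          (8 * Real.exp (3 * C * Real.log x ^ (2 / 3 : ℝ)) * (2 * Real.exp (3 / 2 * Real.log x ^ (2 / 3 : ℝ)))) :=
        mul_le_mul (mul_le_mul_of_nonneg_left hy (by norm_num)) (hI.trans hprod) hIn (by positivity)
    _ = 128 * (x ^ (1 / 2 : ℝ) * Real.exp ((5 / 2 + 3 * C) * Real.log x ^ (2 / 3 : ℝ))) := by rw [← hexp]; ring
    _ ≤ 256 * (x ^ (1 / 2 : ℝ) * Real.exp (cexpo C * Real.log x ^ (2 / 3 : ℝ))) := by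
        have h1 := mul_le_mul_of_nonneg_left hcle hxh
        have h2 : 0 ≤ x ^ (1 / 2 : ℝ) * Real.exp (cexpo C * Real.log x ^ (2 / 3 : ℝ)) := by positivity
        nlinarith

/-- The pointwise bound behind the second piece: for `t ≥ x ≥ e^{64}`,
`B_η(t)/t² ≤ 16 e^{(C + C²/4) L^{2/3}} t^{η − 2}` (`e^{b√log(t+1)} ≤ e^{b²/(4η)} (t+1)^η`, `(t+1)^η ≤ 2t^η`).
[cite: BrouckeVindas2024, proof of Theorem 3.1] -/
theorem Bmaj_div_sq_le {C x t : ℝ} (hC : 0 ≤ C) (hx : Real.exp 64 ≤ x) (ht : x ≤ t) :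
    Bmaj C (eta x) t / t ^ 2 ≤
      16 * Real.exp ((C + C ^ 2 / 4) * Real.log x ^ (2 / 3 : ℝ)) * t ^ (eta x - 2) := by
  have hx0 := x_pos hx
  have hx1 : 1 ≤ x := le_trans (by have := Real.add_one_le_exp (64:ℝ); linarith) hx
  have ht0 : 0 < t := lt_of_lt_of_le hx0 ht
  have ht1 : 1 ≤ t := hx1.trans ht
  have hη := eta_pos hx
  have hη4 := eta_le hx
  have hL0 : 0 < Real.log x := by linarith [log_ge hx]
  obtain ⟨h13, hE1⟩ := log_rpow_facts hx
  have hLt : 0 ≤ Real.log (t + 1) := Real.log_nonneg (by linarith)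
  -- `e^{b √log(t+1)} ≤ e^{b²/(4η)} (t+1)^η`
  have h1 := exp_mul_sqrt_le' (C / Real.sqrt (eta x)) hLt hη
  have hpow : Real.exp (eta x * Real.log (t + 1)) = (t + 1) ^ eta x := by
    rw [Real.rpow_def_of_pos (by linarith), mul_comm]
  rw [hpow] at h1
  -- `b²/(4η) = (C²/4) L^{2/3}`
  have hb2 : (C / Real.sqrt (eta x)) ^ 2 / (4 * eta x) = C ^ 2 / 4 * Real.log x ^ (2 / 3 : ℝ) := by
    rw [div_pow, Real.sq_sqrt hη.le]
    have h23 : Real.log x ^ (2 / 3 : ℝ) = (1 / eta x) * (1 / eta x) := by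
      rw [one_div_eta hx, ← Real.rpow_add hL0]; norm_num
    rw [h23]
    field_simp
  rw [hb2] at h1
  -- `C/η ≤ C L^{2/3}`
  have hCη : C / eta x ≤ C * Real.log x ^ (2 / 3 : ℝ) := by
    rw [div_eq_mul_one_div, one_div_eta hx]; exact mul_le_mul_of_nonneg_left h13 hC
  -- `(t+1)^η ≤ 2 t^η`
  have ht1η : (t + 1) ^ eta x ≤ 2 * t ^ eta x := by
    calc (t + 1) ^ eta x ≤ (2 * t) ^ eta x := Real.rpow_le_rpow (by linarith) (by linarith) hη.le
      _ = 2 ^ eta x * t ^ eta x := Real.mul_rpow (by norm_num) ht0.le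
      _ ≤ 2 * t ^ eta x := by
          refine mul_le_mul_of_nonneg_right ?_ (Real.rpow_nonneg ht0.le _)
          calc (2 : ℝ) ^ eta x ≤ 2 ^ (1 : ℝ) := Real.rpow_le_rpow_of_exponent_le (by norm_num) (by linarith)
            _ = 2 := Real.rpow_one 2
  -- assemble
  have hB : Bmaj C (eta x) t ≤ 8 * Real.exp (C * Real.log x ^ (2 / 3 : ℝ)) *
      (Real.exp (C ^ 2 / 4 * Real.log x ^ (2 / 3 : ℝ)) * (2 * t ^ eta x)) := by
    rw [Bmaj, max_eq_left ht0.le]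
    refine mul_le_mul (mul_le_mul_of_nonneg_left (Real.exp_le_exp.mpr hCη) (by norm_num)) ?_
      (by positivity) (by positivity)
    exact h1.trans (mul_le_mul_of_nonneg_left ht1η (by positivity))
  have hexp : Real.exp (C * Real.log x ^ (2 / 3 : ℝ)) * Real.exp (C ^ 2 / 4 * Real.log x ^ (2 / 3 : ℝ)) =
      Real.exp ((C + C ^ 2 / 4) * Real.log x ^ (2 / 3 : ℝ)) := by
    rw [← Real.exp_add]; congr 1; ring
  have htpow : t ^ eta x / t ^ 2 = t ^ (eta x - 2) := by
    rw [← Real.rpow_natCast t 2, ← Real.rpow_sub ht0]; norm_num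
  calc Bmaj C (eta x) t / t ^ 2
      ≤ 8 * Real.exp (C * Real.log x ^ (2 / 3 : ℝ)) *
          (Real.exp (C ^ 2 / 4 * Real.log x ^ (2 / 3 : ℝ)) * (2 * t ^ eta x)) / t ^ 2 :=
        div_le_div_of_nonneg_right hB (sq_nonneg t)
    _ = 16 * (Real.exp (C * Real.log x ^ (2 / 3 : ℝ)) * Real.exp (C ^ 2 / 4 * Real.log x ^ (2 / 3 : ℝ))) *
          (t ^ eta x / t ^ 2) := by ring
    _ = 16 * Real.exp ((C + C ^ 2 / 4) * Real.log x ^ (2 / 3 : ℝ)) * t ^ (eta x - 2) := by rw [hexp, htpow]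

/-- `t ↦ B_η(t)/t²` is integrable on `(x, ∞)` (dominated by `t^{η−2}`). [cite: BrouckeVindas2024, proof of Theorem 3.1] -/
theorem integrableOn_Bmaj_div_sq {C x : ℝ} (hC : 0 ≤ C) (hx : Real.exp 64 ≤ x) :
    IntegrableOn (fun t : ℝ ↦ Bmaj C (eta x) t / t ^ 2) (Ioi x) := by
  have hx0 := x_pos hx
  have hη := eta_pos hx
  have hη4 := eta_le hx
  have hmeas : Measurable fun t : ℝ ↦ Bmaj C (eta x) t / t ^ 2 :=
    (Bmaj_mono hC hη).measurable.div (measurable_id.pow_const 2)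
  have hlt : eta x - 2 < -1 := by linarith
  refine Integrable.mono' (((integrableOn_Ioi_rpow_of_lt hlt hx0)).const_mul
    (16 * Real.exp ((C + C ^ 2 / 4) * Real.log x ^ (2 / 3 : ℝ)))) hmeas.aestronglyMeasurable ?_
  rw [ae_restrict_iff' measurableSet_Ioi]
  refine Eventually.of_forall fun t ht ↦ ?_
  rw [Real.norm_eq_abs, abs_of_nonneg (div_nonneg (Bmaj_nonneg _ _ _) (sq_nonneg t))]
  exact Bmaj_div_sq_le hC hx (le_of_lt ht)

/-- **Second piece (`|t| > x`)**: `4 y₂^{1+σ_x} ∫ₓ^∞ B_η(t)/t² dt ≤ 512 x^{1/2} e^{c L^{2/3}}` for `y₂ ≤ x + 1`,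
`x ≥ e^{64}` (`∫ₓ^∞ t^{η−2} dt = x^{η−1}/(1−η) ≤ 2x^{η−1}`, `y₂^{1+σ_x} ≤ 4 x^{3/2+η}`).
[cite: BrouckeVindas2024, proof of Theorem 3.1] -/
theorem second_piece_le {C x y₂ : ℝ} (hC : 0 ≤ C) (hx : Real.exp 64 ≤ x) (hy₂ : 0 < y₂) (hy₂x : y₂ ≤ x + 1) :
    4 * y₂ ^ (1 + (1 / 2 + eta x)) * ∫ t in Ioi x, Bmaj C (eta x) t / t ^ 2 ≤
      512 * (x ^ (1 / 2 : ℝ) * Real.exp (cexpo C * Real.log x ^ (2 / 3 : ℝ))) := by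
  have hx0 := x_pos hx
  have hx1 : 1 ≤ x := le_trans (by have := Real.add_one_le_exp (64:ℝ); linarith) hx
  have hη := eta_pos hx
  have hη4 := eta_le hx
  obtain ⟨-, hE1⟩ := log_rpow_facts hx
  have hlt : eta x - 2 < -1 := by linarith
  have hM0 : 0 ≤ 16 * Real.exp ((C + C ^ 2 / 4) * Real.log x ^ (2 / 3 : ℝ)) := by positivity
  -- the integral
  have hI : ∫ t in Ioi x, Bmaj C (eta x) t / t ^ 2 ≤
      16 * Real.exp ((C + C ^ 2 / 4) * Real.log x ^ (2 / 3 : ℝ)) * (2 * x ^ (eta x - 1)) := by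
    have hval : ∫ t in Ioi x, t ^ (eta x - 2) = x ^ (eta x - 1) / (1 - eta x) := by
      rw [integral_Ioi_rpow_of_lt hlt hx0, show eta x - 2 + 1 = eta x - 1 by ring]
      rw [show -x ^ (eta x - 1) / (eta x - 1) = x ^ (eta x - 1) / (1 - eta x) by
        rw [← neg_div_neg_eq, neg_neg, neg_sub]]
    calc ∫ t in Ioi x, Bmaj C (eta x) t / t ^ 2
        ≤ ∫ t in Ioi x, 16 * Real.exp ((C + C ^ 2 / 4) * Real.log x ^ (2 / 3 : ℝ)) * t ^ (eta x - 2) :=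
          setIntegral_mono_on (integrableOn_Bmaj_div_sq hC hx) ((integrableOn_Ioi_rpow_of_lt hlt hx0).const_mul _)
            measurableSet_Ioi fun t ht ↦ Bmaj_div_sq_le hC hx (le_of_lt ht)
      _ = 16 * Real.exp ((C + C ^ 2 / 4) * Real.log x ^ (2 / 3 : ℝ)) * (x ^ (eta x - 1) / (1 - eta x)) := by
          rw [MeasureTheory.integral_const_mul, hval]
      _ ≤ 16 * Real.exp ((C + C ^ 2 / 4) * Real.log x ^ (2 / 3 : ℝ)) * (2 * x ^ (eta x - 1)) := by
          refine mul_le_mul_of_nonneg_left ?_ hM0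
          rw [div_le_iff₀ (by linarith)]
          have : 0 ≤ x ^ (eta x - 1) := Real.rpow_nonneg hx0.le _
          nlinarith
  -- `y₂^{1+σ_x} ≤ 4 x^{3/2+η}`
  have hy : y₂ ^ (1 + (1 / 2 + eta x)) ≤ 4 * x ^ (1 + (1 / 2 + eta x)) := by
    calc y₂ ^ (1 + (1 / 2 + eta x)) ≤ (2 * x) ^ (1 + (1 / 2 + eta x)) :=
          Real.rpow_le_rpow hy₂.le (by linarith) (by linarith)
      _ = 2 ^ (1 + (1 / 2 + eta x)) * x ^ (1 + (1 / 2 + eta x)) := Real.mul_rpow (by norm_num) hx0.le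
      _ ≤ 4 * x ^ (1 + (1 / 2 + eta x)) := by
          refine mul_le_mul_of_nonneg_right ?_ (Real.rpow_nonneg hx0.le _)
          calc (2 : ℝ) ^ (1 + (1 / 2 + eta x)) ≤ 2 ^ (2 : ℝ) :=
                Real.rpow_le_rpow_of_exponent_le (by norm_num) (by linarith)
            _ = 4 := by norm_num
  -- `x^{1+σ_x} x^{η−1} = x^{1/2} (x^η)²`
  have hxpow : x ^ (1 + (1 / 2 + eta x)) * x ^ (eta x - 1) =
      x ^ (1 / 2 : ℝ) * (Real.exp (Real.log x ^ (2 / 3 : ℝ)) * Real.exp (Real.log x ^ (2 / 3 : ℝ))) := by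
    rw [← rpow_eta hx, ← Real.rpow_add hx0, ← Real.rpow_add hx0, ← Real.rpow_add hx0]
    congr 1; ring
  have hexp : Real.exp (Real.log x ^ (2 / 3 : ℝ)) * Real.exp (Real.log x ^ (2 / 3 : ℝ)) *
      Real.exp ((C + C ^ 2 / 4) * Real.log x ^ (2 / 3 : ℝ)) = Real.exp ((2 + C + C ^ 2 / 4) * Real.log x ^ (2 / 3 : ℝ)) := by
    rw [← Real.exp_add, ← Real.exp_add]; congr 1; ring
  have hcle : Real.exp ((2 + C + C ^ 2 / 4) * Real.log x ^ (2 / 3 : ℝ)) ≤ Real.exp (cexpo C * Real.log x ^ (2 / 3 : ℝ)) := by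
    refine Real.exp_le_exp.mpr (mul_le_mul_of_nonneg_right ?_ (le_trans zero_le_one hE1))
    unfold cexpo; nlinarith
  have hIn : 0 ≤ ∫ t in Ioi x, Bmaj C (eta x) t / t ^ 2 :=
    setIntegral_nonneg measurableSet_Ioi fun t _ ↦ div_nonneg (Bmaj_nonneg _ _ _) (sq_nonneg t)
  have hxh : 0 ≤ x ^ (1 / 2 : ℝ) := Real.rpow_nonneg hx0.le _
  calc 4 * y₂ ^ (1 + (1 / 2 + eta x)) * ∫ t in Ioi x, Bmaj C (eta x) t / t ^ 2
      ≤ 4 * (4 * x ^ (1 + (1 / 2 + eta x))) *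
          (16 * Real.exp ((C + C ^ 2 / 4) * Real.log x ^ (2 / 3 : ℝ)) * (2 * x ^ (eta x - 1))) :=
        mul_le_mul (mul_le_mul_of_nonneg_left hy (by norm_num)) hI hIn (by positivity)
    _ = 512 * ((x ^ (1 + (1 / 2 + eta x)) * x ^ (eta x - 1)) *
          Real.exp ((C + C ^ 2 / 4) * Real.log x ^ (2 / 3 : ℝ))) := by ring
    _ = 512 * (x ^ (1 / 2 : ℝ) * Real.exp ((2 + C + C ^ 2 / 4) * Real.log x ^ (2 / 3 : ℝ))) := by
        rw [hxpow, ← hexp]; ring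
    _ ≤ 512 * (x ^ (1 / 2 : ℝ) * Real.exp (cexpo C * Real.log x ^ (2 / 3 : ℝ))) := by
        have h1 := mul_le_mul_of_nonneg_left hcle hxh
        nlinarith

/-! ### The Perron identity with the line moved to `σ_x` -/

/-- On the line `Re s = 3/2`: the Perron formula of order one in terms of `G` and the kernel `K`:
`N₁(y₂) − N₁(y₁) = (1/2π) ∫ K(y₁,y₂; 3/2+it) G(3/2+it) dt`. [cite: BrouckeVindas2024, proof of Theorem 3.1] -/
theorem PerronHyp.rieszCount_sub_eq (h : PerronHyp f g P A K) {y₁ y₂ : ℝ} (hy₁ : 0 < y₁) (hy₂ : 0 < y₂) :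
    ((P.rieszCount y₂ - P.rieszCount y₁ : ℝ) : ℂ) =
      (1 / (2 * π) : ℂ) * ∫ t : ℝ, perronKernel y₁ y₂ (((3 / 2 : ℝ) : ℂ) + t * I) *
        contZeta f g P (((3 / 2 : ℝ) : ℂ) + t * I) := by
  have hsum := h.approx.summable_prime_rpow_neg h.fb (by norm_num : (1:ℝ) < 3 / 2)
  rw [P.rieszCount_sub_eq_integral hy₁ hy₂ (by norm_num : (1:ℝ) < 3 / 2) hsum]
  congr 1
  refine integral_congr_ae (Eventually.of_forall fun t ↦ ?_)
  have hs : 1 < (((3 / 2 : ℝ) : ℂ) + t * I).re := by simp; norm_num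
  show ((y₂ : ℂ) ^ (1 + (((3 / 2 : ℝ) : ℂ) + t * I)) - (y₁ : ℂ) ^ (1 + (((3 / 2 : ℝ) : ℂ) + t * I))) *
      P.zeta (((3 / 2 : ℝ) : ℂ) + t * I) *
        (1 / ((((3 / 2 : ℝ) : ℂ) + t * I) * ((((3 / 2 : ℝ) : ℂ) + t * I) + 1))) =
      perronKernel y₁ y₂ (((3 / 2 : ℝ) : ℂ) + t * I) * contZeta f g P (((3 / 2 : ℝ) : ℂ) + t * I)
  rw [h.zeta_eq hs, perronKernel]
  ring

/-- `u + it ≠ 1` when `u ≠ 1` or `t ≠ 0`. [folklore] -/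
theorem ofReal_add_mul_I_ne_one {u t : ℝ} (hut : u ≠ 1 ∨ t ≠ 0) : (u : ℂ) + t * I ≠ 1 := by
  intro h0
  have h1 := congrArg Complex.re h0
  have h2 := congrArg Complex.im h0
  simp at h1 h2
  rcases hut with hu | ht
  · exact hu h1
  · exact ht h2

/-- **The contour shift** (residue theorem, `perron_integral_eq_residues_add` with the single pole `s = 1`,
residue `a`): for `x ≥ e^{64}`, `1 ≤ y₁ ≤ y₂ ≤ y₁ + 1`,
`∫ K G(3/2+it) dt = 2π a K(y₁,y₂;1) + ∫ K G(σ_x+it) dt`, together with the vertical estimate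
`∫ ‖K G(σ_x+it)‖ dt ≤ 4y₂^{σ_x}∫₀ˣ B/(σ_x+t) + 4y₂^{1+σ_x}∫ₓ^∞ B/t²`. [cite: BrouckeVindas2024, proof of Theorem 3.1] -/
theorem PerronHyp.shift (h : PerronHyp f g P A K) {x y₁ y₂ : ℝ} (hx : Real.exp 64 ≤ x) (hy₁ : 1 ≤ y₁)
    (hy₁₂ : y₁ ≤ y₂) (hy₂ : y₂ ≤ y₁ + 1) :
    (∫ t : ℝ, perronKernel y₁ y₂ (((3 / 2 : ℝ) : ℂ) + t * I) * contZeta f g P (((3 / 2 : ℝ) : ℂ) + t * I)) =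
        2 * π * (res f g P * perronKernel y₁ y₂ ((1 : ℝ) : ℂ)) +
          ∫ t : ℝ, perronKernel y₁ y₂ (((1 / 2 + eta x : ℝ) : ℂ) + t * I) *
            contZeta f g P (((1 / 2 + eta x : ℝ) : ℂ) + t * I) ∧
      (∫ t : ℝ, ‖perronKernel y₁ y₂ (((1 / 2 + eta x : ℝ) : ℂ) + t * I) *
          contZeta f g P (((1 / 2 + eta x : ℝ) : ℂ) + t * I)‖) ≤
        4 * y₂ ^ (1 / 2 + eta x) * (∫ t in Ioc 0 x, Bmaj (CZ P A K) (eta x) t / (1 / 2 + eta x + t)) +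
          4 * y₂ ^ (1 + (1 / 2 + eta x)) * ∫ t in Ioi x, Bmaj (CZ P A K) (eta x) t / t ^ 2 := by
  have hx0 := x_pos hx
  have hη := eta_pos hx
  have hη4 := eta_le hx
  have hC : 0 ≤ CZ P A K := h.CZ_nonneg
  have hy₁0 : 0 < y₁ := by linarith
  -- abbreviations (no rewriting across them is needed)
  have hσ₁half : (1 : ℝ) / 2 < 1 / 2 + eta x := by linarith
  have hσ₁ne : 1 / 2 + eta x ≠ 1 := by linarith
  have hσ₁abs : 1 / 4 ≤ |1 / 2 + eta x - 1| := by rw [abs_of_neg (by linarith)]; linarith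
  have hκabs : 1 / 4 ≤ |(3 : ℝ) / 2 - 1| := by norm_num
  -- `G = polePart + H` off `s = 1`
  have hGeq : ∀ {u : ℝ} (t : ℝ), (u ≠ 1 ∨ t ≠ 0) →
      polePart {1} (fun _ ↦ res f g P) ((u : ℂ) + t * I) + H f g P ((u : ℂ) + t * I) =
        contZeta f g P ((u : ℂ) + t * I) :=
    fun t hut ↦ (contZeta_eq_polePart_add_H (ofReal_add_mul_I_ne_one hut)).symm
  -- the bound on vertical lines `Re s = u` with `|u − 1| ≥ 1/4`
  have hline : ∀ {u : ℝ}, 1 / 2 + eta x ≤ u → u ≤ 3 / 2 → 1 / 4 ≤ |u - 1| → ∀ t : ℝ,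
      ‖contZeta f g P ((u : ℂ) + t * I)‖ ≤ Bmaj (CZ P A K) (eta x) |t| := by
    intro u hu1 hu2 hu3 t
    have hd : 1 / 4 ≤ ‖((u : ℂ) + t * I) - 1‖ := by
      refine hu3.trans ?_
      have := abs_re_le_norm (((u : ℂ) + t * I) - 1)
      simpa using this
    have := h.norm_contZeta_le hη (s := (u : ℂ) + t * I) (by simpa using hu1) (by simpa using hu2) hd
    simpa using this
  -- the bound on the strip for `|T| ≥ 1`
  have hstrip : ∀ T : ℝ, 1 ≤ |T| → ∀ u ∈ Icc (1 / 2 + eta x) (3 / 2 : ℝ),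
      ‖polePart {1} (fun _ ↦ res f g P) ((u : ℂ) + T * I) + H f g P ((u : ℂ) + T * I)‖ ≤
        Bmaj (CZ P A K) (eta x) |T| := by
    intro T hT u hu
    have hT0 : T ≠ 0 := by intro h0; rw [h0, abs_zero] at hT; norm_num at hT
    rw [hGeq T (Or.inr hT0)]
    have hd : 1 / 4 ≤ ‖((u : ℂ) + T * I) - 1‖ := by
      have := abs_im_le_norm (((u : ℂ) + T * I) - 1)
      simp at this
      linarith
    have := h.norm_contZeta_le hη (s := (u : ℂ) + T * I) (by simpa using hu.1) (by simpa using hu.2) hd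
    simpa using this
  -- measurability on the two lines
  have hmeas : ∀ {u : ℝ}, 1 / 2 < u → u ≠ 1 →
      AEStronglyMeasurable (fun t : ℝ ↦ polePart {1} (fun _ ↦ res f g P) ((u : ℂ) + t * I) +
        H f g P ((u : ℂ) + t * I)) volume := by
    intro u hu hu1
    have hc := h.continuous_contZeta_vertical hu hu1
    exact hc.aestronglyMeasurable.congr (Eventually.of_forall fun t ↦ (hGeq t (Or.inl hu1)).symm)
  -- the vertical estimates on both lines
  have hBi := integrableOn_Bmaj_div_sq hC hx
  have hV₁ := perron_vertical_norm_le (G := fun s ↦ polePart {1} (fun _ ↦ res f g P) s + H f g P s)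
    (B := Bmaj (CZ P A K) (eta x)) (σ := 1 / 2 + eta x) (lt_trans (by norm_num) hσ₁half) hy₁0 hy₁₂ hy₂ hx0
    (hmeas hσ₁half hσ₁ne)
    (fun t ↦ by rw [hGeq t (Or.inl hσ₁ne)]; exact hline le_rfl (by linarith) hσ₁abs t)
    (Bmaj_nonneg _ _ _) (Bmaj_mono hC hη) hBi
  have hVκ := perron_vertical_norm_le (G := fun s ↦ polePart {1} (fun _ ↦ res f g P) s + H f g P s)
    (B := Bmaj (CZ P A K) (eta x)) (σ := (3 / 2 : ℝ)) (by norm_num) hy₁0 hy₁₂ hy₂ hx0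
    (hmeas (by norm_num) (by norm_num))
    (fun t ↦ by rw [hGeq t (Or.inl (by norm_num))]; exact hline (by linarith) le_rfl hκabs t)
    (Bmaj_nonneg _ _ _) (Bmaj_mono hC hη) hBi
  -- the residue theorem
  have hres := perron_integral_eq_residues_add (H := H f g P) (B := Bmaj (CZ P A K) (eta x)) (σ₀ := 1 / 2)
    (σ₁ := 1 / 2 + eta x) (κ := (3 / 2 : ℝ)) (y₁ := y₁) (y₂ := y₂) (T₁ := 1) {1} (fun _ ↦ res f g P)
    (by norm_num) hσ₁half (by linarith) hy₁ hy₁₂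
    (fun p hp ↦ by rw [Finset.mem_singleton] at hp; rw [hp]; constructor <;> linarith)
    h.differentiableOn_H hVκ.1 hV₁.1 hstrip (tendsto_Bmaj_div_sq (CZ P A K) (eta x))
  -- translate back to `contZeta`
  have hIκ : (∫ t : ℝ, perronKernel y₁ y₂ (((3 / 2 : ℝ) : ℂ) + t * I) * contZeta f g P (((3 / 2 : ℝ) : ℂ) + t * I)) =
      ∫ t : ℝ, perronKernel y₁ y₂ (((3 / 2 : ℝ) : ℂ) + t * I) *
        (polePart {1} (fun _ ↦ res f g P) (((3 / 2 : ℝ) : ℂ) + t * I) + H f g P (((3 / 2 : ℝ) : ℂ) + t * I)) :=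
    integral_congr_ae (Eventually.of_forall fun t ↦ by beta_reduce; rw [hGeq t (Or.inl (by norm_num))])
  have hI₁ : (∫ t : ℝ, perronKernel y₁ y₂ (((1 / 2 + eta x : ℝ) : ℂ) + t * I) *
        contZeta f g P (((1 / 2 + eta x : ℝ) : ℂ) + t * I)) =
      ∫ t : ℝ, perronKernel y₁ y₂ (((1 / 2 + eta x : ℝ) : ℂ) + t * I) *
        (polePart {1} (fun _ ↦ res f g P) (((1 / 2 + eta x : ℝ) : ℂ) + t * I) +
          H f g P (((1 / 2 + eta x : ℝ) : ℂ) + t * I)) :=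
    integral_congr_ae (Eventually.of_forall fun t ↦ by beta_reduce; rw [hGeq t (Or.inl hσ₁ne)])
  have hI₁' : (∫ t : ℝ, ‖perronKernel y₁ y₂ (((1 / 2 + eta x : ℝ) : ℂ) + t * I) *
        contZeta f g P (((1 / 2 + eta x : ℝ) : ℂ) + t * I)‖) =
      ∫ t : ℝ, ‖perronKernel y₁ y₂ (((1 / 2 + eta x : ℝ) : ℂ) + t * I) *
        (polePart {1} (fun _ ↦ res f g P) (((1 / 2 + eta x : ℝ) : ℂ) + t * I) +
          H f g P (((1 / 2 + eta x : ℝ) : ℂ) + t * I))‖ :=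
    integral_congr_ae (Eventually.of_forall fun t ↦ by beta_reduce; rw [hGeq t (Or.inl hσ₁ne)])
  refine ⟨?_, ?_⟩
  · rw [hIκ, hres, hI₁, Finset.sum_singleton]
  · rw [hI₁']
    exact hV₁.2

/-- The main term: `K(y₁, y₂; 1) = (y₂² − y₁²)/2`. [cite: BrouckeVindas2024, proof of Theorem 3.1] -/
theorem perronKernel_one (y₁ y₂ : ℝ) :
    perronKernel y₁ y₂ ((1 : ℝ) : ℂ) = (((y₂ ^ 2 - y₁ ^ 2) / 2 : ℝ) : ℂ) := by
  rw [perronKernel]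
  have h2 : (1 : ℂ) + ((1 : ℝ) : ℂ) = ((2 : ℕ) : ℂ) := by push_cast; norm_num
  rw [h2, Complex.cpow_natCast, Complex.cpow_natCast]
  push_cast
  ring

/-- **The Perron estimate for one pair `(y₁, y₂)`**: for `x ≥ e^{64}`, `1 ≤ y₁ ≤ y₂ ≤ y₁ + 1`, `y₂ ≤ x + 1`,
`|N₁(y₂) − N₁(y₁) − a (y₂² − y₁²)/2| ≤ (768/2π) x^{1/2} e^{c L^{2/3}}`. [cite: BrouckeVindas2024, proof of Theorem 3.1] -/
theorem PerronHyp.abs_rieszCount_sub_sub_le (h : PerronHyp f g P A K) {x y₁ y₂ : ℝ} (hx : Real.exp 64 ≤ x)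
    (hy₁ : 1 ≤ y₁) (hy₁₂ : y₁ ≤ y₂) (hy₂ : y₂ ≤ y₁ + 1) (hy₂x : y₂ ≤ x + 1) :
    |P.rieszCount y₂ - P.rieszCount y₁ - (res f g P).re * ((y₂ ^ 2 - y₁ ^ 2) / 2)| ≤
      768 / (2 * π) * (x ^ (1 / 2 : ℝ) * Real.exp (cexpo (CZ P A K) * Real.log x ^ (2 / 3 : ℝ))) := by
  have hy₁0 : 0 < y₁ := by linarith
  have hy₂0 : 0 < y₂ := by linarith
  have hC : 0 ≤ CZ P A K := h.CZ_nonneg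
  obtain ⟨hshift, hvert⟩ := h.shift hx hy₁ hy₁₂ hy₂
  set Iσ : ℂ := ∫ t : ℝ, perronKernel y₁ y₂ (((1 / 2 + eta x : ℝ) : ℂ) + t * I) *
    contZeta f g P (((1 / 2 + eta x : ℝ) : ℂ) + t * I) with hIσ
  -- the identity `ΔN₁ = a (y₂² − y₁²)/2 + Re(Iσ)/(2π)`
  have hid : ((P.rieszCount y₂ - P.rieszCount y₁ : ℝ) : ℂ) =
      (((res f g P).re * ((y₂ ^ 2 - y₁ ^ 2) / 2) : ℝ) : ℂ) + (1 / (2 * π) : ℂ) * Iσ := by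
    rw [h.rieszCount_sub_eq hy₁0 hy₂0, hshift, perronKernel_one, mul_add]
    congr 1
    conv_lhs => rw [h.res_eq_ofReal]
    have hπ : (π : ℂ) ≠ 0 := by exact_mod_cast Real.pi_pos.ne'
    push_cast
    field_simp
  have hre : P.rieszCount y₂ - P.rieszCount y₁ =
      (res f g P).re * ((y₂ ^ 2 - y₁ ^ 2) / 2) + 1 / (2 * π) * Iσ.re := by
    have := congrArg Complex.re hid
    rw [ofReal_re, add_re, ofReal_re] at this
    rw [this]
    congr 1
    have h1 : (1 / (2 * π) : ℂ) = ((1 / (2 * π) : ℝ) : ℂ) := by push_cast; ring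
    rw [h1, Complex.re_ofReal_mul]
  -- the estimate
  have hI : ‖Iσ‖ ≤ 768 * (x ^ (1 / 2 : ℝ) * Real.exp (cexpo (CZ P A K) * Real.log x ^ (2 / 3 : ℝ))) := by
    refine (MeasureTheory.norm_integral_le_integral_norm _).trans (hvert.trans ?_)
    have h1 := first_piece_le hC hx hy₂0 hy₂x
    have h2 := second_piece_le hC hx hy₂0 hy₂x
    linarith
  rw [hre, add_sub_cancel_left, abs_mul, abs_of_pos (by positivity : 0 < 1 / (2 * π))]
  calc 1 / (2 * π) * |Iσ.re| ≤ 1 / (2 * π) * (768 * (x ^ (1 / 2 : ℝ) *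
        Real.exp (cexpo (CZ P A K) * Real.log x ^ (2 / 3 : ℝ)))) :=
        mul_le_mul_of_nonneg_left ((Complex.abs_re_le_norm _).trans hI) (by positivity)
    _ = 768 / (2 * π) * (x ^ (1 / 2 : ℝ) * Real.exp (cexpo (CZ P A K) * Real.log x ^ (2 / 3 : ℝ))) := by ring

/-- **BV Theorem 3.1, the integer clause** (in the form of the proof): for `x ≥ e^{64}`,
`|N_P(x) − a x| ≤ (a/2 + 128) x^{1/2} exp(c (log x)^{2/3})` with `a = Re e^{Z(1)} > 0` and
`c = 5/2 + 3C + C²/4`, `C` the constant of (3.2) (`N₁(x) − N₁(x−1) ≤ N(x) ≤ N₁(x+1) − N₁(x)` and the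
estimate above for the pairs `(x, x+1)`, `(x−1, x)`). [cite: BrouckeVindas2024, Theorem 3.1 (proof)] -/
theorem PerronHyp.abs_intCount_sub_le (h : PerronHyp f g P A K) {x : ℝ} (hx : Real.exp 64 ≤ x) :
    |(P.intCount x : ℝ) - (res f g P).re * x| ≤
      ((res f g P).re / 2 + 128) * (x ^ (1 / 2 : ℝ) * Real.exp (cexpo (CZ P A K) * Real.log x ^ (2 / 3 : ℝ))) := by
  have hx0 := x_pos hx
  have hx2 : 2 ≤ x := le_trans (by have := Real.add_one_le_exp (64:ℝ); linarith) hx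
  have ha0 : 0 < (res f g P).re := h.res_real_pos.2
  have hGx1 : 1 ≤ x ^ (1 / 2 : ℝ) * Real.exp (cexpo (CZ P A K) * Real.log x ^ (2 / 3 : ℝ)) := by
    have h1 : 1 ≤ x ^ (1 / 2 : ℝ) := Real.one_le_rpow (by linarith) (by norm_num)
    have h2 : 1 ≤ Real.exp (cexpo (CZ P A K) * Real.log x ^ (2 / 3 : ℝ)) := by
      refine Real.one_le_exp (mul_nonneg ?_ (Real.rpow_nonneg (Real.log_nonneg (by linarith)) _))
      have := h.CZ_nonneg; unfold cexpo; positivity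
    nlinarith
  -- upper bound via `(x, x+1)`, lower bound via `(x−1, x)`
  have hup := h.abs_rieszCount_sub_sub_le hx (by linarith : (1:ℝ) ≤ x) (by linarith : x ≤ x + 1) le_rfl le_rfl
  have hup' := P.intCount_le_rieszCount_sub x
  have hlo := h.abs_rieszCount_sub_sub_le hx (by linarith : (1:ℝ) ≤ x - 1) (by linarith : x - 1 ≤ x)
    (by linarith) (by linarith)
  have hlo' := P.rieszCount_sub_le_intCount x
  have e1 : ((x + 1) ^ 2 - x ^ 2) / 2 = x + 1 / 2 := by ring
  have e2 : (x ^ 2 - (x - 1) ^ 2) / 2 = x - 1 / 2 := by ring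
  rw [e1] at hup
  rw [e2] at hlo
  have hπ : 768 / (2 * π) ≤ 128 := by
    rw [div_le_iff₀ (by positivity)]
    have := Real.pi_gt_three; nlinarith
  have hB : 768 / (2 * π) * (x ^ (1 / 2 : ℝ) * Real.exp (cexpo (CZ P A K) * Real.log x ^ (2 / 3 : ℝ))) ≤
      128 * (x ^ (1 / 2 : ℝ) * Real.exp (cexpo (CZ P A K) * Real.log x ^ (2 / 3 : ℝ))) :=
    mul_le_mul_of_nonneg_right hπ (by linarith)
  rw [abs_le] at hup hlo ⊢
  constructor <;> nlinarith [hup.1, hup.2, hlo.1, hlo.2, ha0]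

end BV

end Literature.NumberTheory.BeurlingPrimes
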